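import Literature.Geometry.DiscreteGeometry.KissingSearchDefs
import Mathlib.Analysis.SpecialFunctions.Trigonometric.Inverse
import HarnessLib

/-!
# Soundness of the numeric kernel of the kissing growth search

Topic `Literature/Geometry/DiscreteGeometry`; provefact brick for `Hales2012_contactGraphTame` /
`Hales2012_contactGraphFccOrHcp` (after `KissingSearchCheck.lean`, the computable checker, and
`KissingSearchDefs.lean`, which defines `Encl`, `SymMem`, `Pfun`, `pt3`, `symsList`, `ValidDom`).
Everything here is PROVED, nothing is named:

* Part A — the bracket code (`mkBr`, `brLo`, `brHi`, `brHull`) and the enclosure relation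
  `Encl br θ` (`br ≠ NOBR` and `brLo br · δ ≤ θ ≤ brHi br · δ`), stable under hulls;
* Part B — the ladders: `ladDown q · δ ≤ arccos q ≤ ladUp q · δ`, `ladUp q ≤ NLAD`;
* Part C — **`basic_sound`**: if `x, y, z` lie in the cells of the symbols `a, b, c`, the
  circumradius polynomial is positive and `θ ∈ [0, π]` satisfies the spherical law of cosines
  `cos θ · √(1-x²) √(1-y²) = z - x y`, then `Encl (basic a b c) θ` (Moore's inclusion theorem
  for the enclosures `RExpr.enclose`, then `arccos` is antitone);
* Part D — the tables and folds: `btab = basic`, `foldRange`/`foldSyms` as list folds,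
  `rangeC_sound`, `t1_eq`, **`rangeBr_sound`**, and `THMIN_le`.

## References
* R. E. Moore, *Interval Analysis* (1966), Theorem 3.1. [`Moore1966`]
* T. C. Hales, arXiv:1209.6043 (2012), proof of Lemma 9. [`Hales2012`]
-/

namespace Literature.Geometry.DiscreteGeometry

namespace KissingSearch

open Real Literature.Analysis.ValidatedNumerics KissingLP NonemptyInterval

/-! ### Part A. Bracket codes and the enclosure relation -/

/-- `brHi (mkBr lo hi) = hi` for `hi < 16384`. [folklore] -/
theorem brHi_mkBr (lo hi : ℕ) (h : hi < 16384) : brHi (mkBr lo hi) = hi := by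
  unfold brHi mkBr; omega

/-- `brLo (mkBr lo hi) = lo` for `hi < 16384`. [folklore] -/
theorem brLo_mkBr (lo hi : ℕ) (h : hi < 16384) : brLo (mkBr lo hi) = lo := by
  unfold brLo mkBr; omega

/-- A made bracket is not `NOBR`. [folklore] -/
theorem mkBr_ne_NOBR (lo hi : ℕ) : mkBr lo hi ≠ NOBR := by
  unfold mkBr NOBR; omega

/-- `brHi br < 16384`. [folklore] -/
theorem brHi_lt (br : ℕ) : brHi br < 16384 := by
  unfold brHi; omega


/-- `δ > 0` as a real. [folklore] -/
theorem delta_pos : (0 : ℝ) < (δ : ℝ) := by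
  unfold δ; push_cast; norm_num

/-- Enclosure survives a hull on the right. [folklore] -/
theorem Encl.hull_left {x y : ℕ} {θ : ℝ} (h : Encl x θ) : Encl (brHull x y) θ := by
  obtain ⟨hx, hlo, hhi⟩ := h
  unfold brHull
  by_cases hy : y = NOBR
  · rw [if_neg hx, if_pos hy]; exact ⟨hx, hlo, hhi⟩
  · rw [if_neg hx, if_neg hy]
    refine ⟨mkBr_ne_NOBR _ _, ?_, ?_⟩
    · rw [brLo_mkBr _ _ (max_lt (brHi_lt x) (brHi_lt y))]
      refine le_trans ?_ hlo
      have : ((min (brLo x) (brLo y) : ℕ) : ℝ) ≤ brLo x := by exact_mod_cast min_le_left _ _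
      exact mul_le_mul_of_nonneg_right this delta_pos.le
    · rw [brHi_mkBr _ _ (max_lt (brHi_lt x) (brHi_lt y))]
      refine le_trans hhi ?_
      have : ((brHi x : ℕ) : ℝ) ≤ (max (brHi x) (brHi y) : ℕ) := by exact_mod_cast le_max_left _ _
      exact mul_le_mul_of_nonneg_right this delta_pos.le

/-- Enclosure survives a hull on the left. [folklore] -/
theorem Encl.hull_right {x y : ℕ} {θ : ℝ} (h : Encl y θ) : Encl (brHull x y) θ := by
  obtain ⟨hy, hlo, hhi⟩ := h
  unfold brHull
  by_cases hx : x = NOBR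
  · rw [if_pos hx]; exact ⟨hy, hlo, hhi⟩
  · rw [if_neg hx, if_neg hy]
    refine ⟨mkBr_ne_NOBR _ _, ?_, ?_⟩
    · rw [brLo_mkBr _ _ (max_lt (brHi_lt x) (brHi_lt y))]
      refine le_trans ?_ hlo
      have : ((min (brLo x) (brLo y) : ℕ) : ℝ) ≤ brLo y := by exact_mod_cast min_le_right _ _
      exact mul_le_mul_of_nonneg_right this delta_pos.le
    · rw [brHi_mkBr _ _ (max_lt (brHi_lt x) (brHi_lt y))]
      refine le_trans hhi ?_
      have : ((brHi y : ℕ) : ℝ) ≤ (max (brHi x) (brHi y) : ℕ) := by exact_mod_cast le_max_right _ _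
      exact mul_le_mul_of_nonneg_right this delta_pos.le

/-- A fold of hulls encloses whatever the accumulator encloses. [folklore] -/
theorem encl_foldl_of_acc {L : List ℕ} {g : ℕ → ℕ} {acc : ℕ} {θ : ℝ} (h : Encl acc θ) :
    Encl (L.foldl (fun acc c => brHull acc (g c)) acc) θ := by
  induction L generalizing acc with
  | nil => exact h
  | cons c L ih => exact ih h.hull_left

/-- A fold of hulls encloses whatever one of its terms encloses. [folklore] -/
theorem encl_foldl_of_mem {L : List ℕ} {g : ℕ → ℕ} (acc : ℕ) {θ : ℝ} {σ : ℕ} (hσ : σ ∈ L)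
    (h : Encl (g σ) θ) : Encl (L.foldl (fun acc c => brHull acc (g c)) acc) θ := by
  induction L generalizing acc with
  | nil => exact absurd hσ (by simp)
  | cons c L ih =>
    rw [List.foldl_cons]
    rcases List.mem_cons.1 hσ with rfl | hmem
    · exact encl_foldl_of_acc h.hull_right
    · exact ih _ hmem

/-! ### Part B. The ladders -/

/-- `bsearchMin P fuel lo hi ≤ hi` when `lo ≤ hi`. [folklore] -/
theorem bsearchMin_le (P : ℕ → Bool) : ∀ (fuel lo hi : ℕ), lo ≤ hi → bsearchMin P fuel lo hi ≤ hi
  | 0, lo, hi, _ => by simp [bsearchMin]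
  | fuel + 1, lo, hi, h => by
    unfold bsearchMin
    simp only
    split_ifs with h1 h2
    · exact le_rfl
    · exact (bsearchMin_le P fuel lo _ (by omega)).trans (by omega)
    · exact bsearchMin_le P fuel _ hi (by omega)

/-- `ladUp q ≤ NLAD`. [folklore] -/
theorem ladUp_le (q : ℚ) : ladUp q ≤ NLAD := by
  unfold ladUp
  simp only
  split_ifs
  · exact bsearchMin_le _ _ _ _ (Nat.zero_le _)
  · exact le_rfl

/-- `ladDown q ≤ NLAD` (the certificate `leArccosB` requires `k δ ≤ 13/5 < NLAD δ`). [folklore] -/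
theorem ladDown_le (q : ℚ) : ladDown q ≤ NLAD := by
  unfold ladDown ladderDown
  simp only
  generalize bsearchMax (fun k => leArccosB (↑k * δ) q) (NLAD + 1) 0 (NLAD + 1) = k
  split_ifs with h
  · have h2 : (k : ℚ) * δ ≤ 13 / 5 := by
      unfold leArccosB at h
      simp only [Bool.and_eq_true, decide_eq_true_eq] at h
      exact h.1.2
    by_contra hlt
    rw [not_le] at hlt
    have hk : (NLAD : ℚ) + 1 ≤ k := by exact_mod_cast hlt
    unfold NLAD at hk
    unfold δ at h2
    push_cast at hk
    linarith
  · exact Nat.zero_le _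

/-- **Lower ladder**: `ladDown q · δ ≤ arccos q`. [folklore] -/
theorem ladDown_mul_le_arccos (q : ℚ) : ((ladDown q : ℕ) : ℝ) * (δ : ℝ) ≤ arccos q := by
  have h := ladderDown_mul_le_arccos δ NLAD q
  unfold ladDown
  exact_mod_cast h

/-- Soundness of the monotone certificate `upOK`. [folklore] -/
theorem arccos_le_of_upOK {q : ℚ} {k : ℕ} (h : upOK q k = true) : arccos q ≤ (k : ℝ) * (δ : ℝ) := by
  unfold upOK at h
  have h1 := arccos_le_of_arccosLeB h
  refine h1.trans ?_
  have : ((min ((k : ℚ) * δ) (13 / 5) : ℚ) : ℝ) ≤ (((k : ℚ) * δ : ℚ) : ℝ) := by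
    exact_mod_cast min_le_left _ _
  refine this.trans ?_
  push_cast
  exact le_rfl

/-- **Upper ladder**: `arccos q ≤ ladUp q · δ`. [folklore] -/
theorem pi_lt_NLAD_mul : π < ((NLAD : ℕ) : ℝ) * (δ : ℝ) := by
  have := pi_lt_d4
  unfold NLAD δ
  push_cast
  norm_num
  linarith

/-- **Upper ladder**: `arccos q ≤ ladUp q · δ` (the fallback rung `NLAD` is above `π`).
[folklore] -/
theorem arccos_le_ladUp_mul (q : ℚ) : arccos q ≤ ((ladUp q : ℕ) : ℝ) * (δ : ℝ) := by
  unfold ladUp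
  simp only
  split_ifs with h
  · exact arccos_le_of_upOK h
  · exact (arccos_le_pi _).trans pi_lt_NLAD_mul.le

/-! ### Part C. Soundness of the basic bracket -/




/-- The point lies in the box of the symbols. [folklore] -/
theorem pt3_mem_symBox {a b c : ℕ} {x y z : ℝ} (hx : SymMem a x) (hy : SymMem b y)
    (hz : SymMem c z) : ∀ i, pt3 x y z i ∈ (symBox a b c i).ratCast ℝ := by
  intro i
  unfold pt3 symBox
  by_cases h0 : i = 0
  · simp only [h0, ↓reduceIte]; exact hx
  · by_cases h1 : i = 1
    · simp only [h1, ↓reduceIte]; exact hy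
    · simp only [h0, h1, ↓reduceIte]; exact hz

/-- Evaluation of `pExpr`. [folklore] -/
theorem eval_pExpr (x y z : ℝ) : pExpr.eval (pt3 x y z) = Pfun x y z := by
  simp only [pExpr, RExpr.eval, pt3]
  norm_num [Pfun]
  ring

/-- Evaluation of `qExpr`. [folklore] -/
theorem eval_qExpr (x y z : ℝ) :
    qExpr.eval (pt3 x y z) = (z - x * y) * (Real.sqrt (1 - x ^ 2) * Real.sqrt (1 - y ^ 2))⁻¹ := by
  simp only [qExpr, RExpr.eval, pt3]
  norm_num

/-- **Soundness of the basic bracket.**  If `x, y, z` lie in the cells of `a, b, c`, `x², y² < 1`,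
the circumradius polynomial is positive, and `θ ∈ [0, π]` satisfies the spherical law of
cosines `cos θ · (√(1-x²) √(1-y²)) = z - x y`, then `basic a b c` encloses `θ`.
[cite: Moore1966, Theorem 3.1] -/
theorem basic_sound {a b c : ℕ} {x y z θ : ℝ} (hx : SymMem a x) (hy : SymMem b y) (hz : SymMem c z)
    (hx1 : x ^ 2 < 1) (hy1 : y ^ 2 < 1) (hP : 0 < Pfun x y z) (hθ0 : 0 ≤ θ) (hθπ : θ ≤ π)
    (hcos : Real.cos θ * (Real.sqrt (1 - x ^ 2) * Real.sqrt (1 - y ^ 2)) = z - x * y) :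
    Encl (basic a b c) θ := by
  have hmem := pt3_mem_symBox hx hy hz
  have hθN : θ ≤ ((NLAD : ℕ) : ℝ) * (δ : ℝ) := hθπ.trans pi_lt_NLAD_mul.le
  have wide : Encl (mkBr 0 NLAD) θ := by
    refine ⟨mkBr_ne_NOBR _ _, ?_, ?_⟩
    · rw [brLo_mkBr _ _ (by unfold NLAD; norm_num)]; simpa using hθ0
    · rw [brHi_mkBr _ _ (by unfold NLAD; norm_num)]; exact hθN
  unfold basic
  -- the circumradius enclosure
  cases hPe : pExpr.enclose PREC ITERS (symBox a b c) with
  | none => simpa using wide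
  | some P =>
    dsimp only
    have hPmem := RExpr.eval_mem_enclose hmem pExpr hPe
    rw [eval_pExpr] at hPmem
    have hPsnd : Pfun x y z ≤ (P.snd : ℝ) := (mem_ratCast_iff.1 hPmem).2
    have hnot : ¬ P.snd ≤ 0 := by
      intro h
      have : ((P.snd : ℚ) : ℝ) ≤ 0 := by exact_mod_cast h
      linarith
    rw [if_neg hnot]
    cases hQe : qExpr.enclose PREC ITERS (symBox a b c) with
    | none => simpa using wide
    | some Q =>
      dsimp only
      have hQmem := RExpr.eval_mem_enclose hmem qExpr hQe
      rw [eval_qExpr] at hQmem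
      -- cos θ is the quotient
      have hsx : 0 < Real.sqrt (1 - x ^ 2) := Real.sqrt_pos.2 (by linarith)
      have hsy : 0 < Real.sqrt (1 - y ^ 2) := Real.sqrt_pos.2 (by linarith)
      have hD : 0 < Real.sqrt (1 - x ^ 2) * Real.sqrt (1 - y ^ 2) := mul_pos hsx hsy
      have hq : (z - x * y) * (Real.sqrt (1 - x ^ 2) * Real.sqrt (1 - y ^ 2))⁻¹ = Real.cos θ := by
        rw [← hcos, mul_inv_cancel_right₀ hD.ne']
      rw [hq] at hQmem
      obtain ⟨hQ1, hQ2⟩ := mem_ratCast_iff.1 hQmem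
      have hθeq : arccos (Real.cos θ) = θ := arccos_cos hθ0 hθπ
      refine ⟨mkBr_ne_NOBR _ _, ?_, ?_⟩
      · rw [brLo_mkBr _ _ (lt_of_le_of_lt (ladUp_le _) (by unfold NLAD; norm_num))]
        refine (ladDown_mul_le_arccos _).trans ?_
        rw [← hθeq]
        apply arccos_le_arccos
        refine hQ2.trans ?_
        exact_mod_cast le_dyCeil PREC Q.snd
      · rw [brHi_mkBr _ _ (lt_of_le_of_lt (ladUp_le _) (by unfold NLAD; norm_num))]
        refine le_trans ?_ (arccos_le_ladUp_mul _)
        rw [← hθeq]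
        apply arccos_le_arccos
        refine le_trans ?_ hQ1
        exact_mod_cast dyFloor_le PREC Q.fst

/-- The endpoints of the cell of a symbol bound its elements: `|x| ≤ 1/2` for the contact symbol
and for the cells `1 … K`. [folklore] -/
theorem abs_le_half_of_symMem {σ : ℕ} {x : ℝ} (hσ : σ ≤ K) (h : SymMem σ x) :
    -(1 / 2 : ℝ) ≤ x ∧ x ≤ 1 / 2 := by
  unfold SymMem symIv at h
  by_cases h0 : σ = 0
  · simp only [h0, ↓reduceIte] at h
    rw [mem_ratCast_iff] at h
    unfold mkIv at h
    simp only [min_self, max_self] at h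
    push_cast at h
    exact ⟨by linarith [h.1], by linarith [h.2]⟩
  · simp only [h0, ↓reduceIte] at h
    rw [mem_ratCast_iff] at h
    unfold mkIv at h
    simp only at h
    have hlo : (-(1 / 2) : ℚ) ≤ min (gridPt (σ - 1)) (gridPt σ) := by
      have : ∀ j : ℕ, (-(1/2) : ℚ) ≤ gridPt j := fun j => by
        have hnn : (0 : ℚ) ≤ (κ0 + 1 / 2) * j / K := by unfold κ0 K; positivity
        unfold gridPt; linarith
      exact le_min (this _) (this _)
    have hhi : max (gridPt (σ - 1)) (gridPt σ) ≤ (1 / 2 : ℚ) := by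
      have : ∀ j : ℕ, j ≤ K → gridPt j ≤ (1/2 : ℚ) := fun j hj => by
        unfold gridPt κ0 K at *
        have : (j : ℚ) ≤ 15 := by exact_mod_cast hj
        nlinarith
      exact max_le (this _ (by omega)) (this _ hσ)
    have hlo' : ((-(1 / 2) : ℚ) : ℝ) ≤ x := le_trans (by exact_mod_cast hlo) h.1
    have hhi' : x ≤ ((1 / 2 : ℚ) : ℝ) := le_trans h.2 (by exact_mod_cast hhi)
    push_cast at hlo' hhi'
    exact ⟨hlo', hhi'⟩

/-- Hence `x² < 1` on every cell. [folklore] -/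
theorem sq_lt_one_of_symMem {σ : ℕ} {x : ℝ} (hσ : σ ≤ K) (h : SymMem σ x) : x ^ 2 < 1 := by
  obtain ⟨h1, h2⟩ := abs_le_half_of_symMem hσ h
  nlinarith

/-! ### Part D. Tables and folds -/

/-- `NS = 16`. [folklore] -/
theorem NS_eq : NS = 16 := by unfold NS K; rfl

/-- **The table lookup `btab` is `basic`** (in range). [folklore] -/
theorem btab_eq {a b c : ℕ} (ha : a < NS) (hb : b < NS) (hc : c < NS) : btab a b c = basic a b c := by
  unfold btab BTAB
  rw [NS_eq] at ha hb hc ⊢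
  have hidx : (a * 16 + b) * 16 + c < 16 * 16 * 16 := by omega
  rw [Array.getD_eq_getD_getElem?, Array.getElem?_ofFn]
  simp only [hidx, ↓reduceDIte, Option.getD_some]
  congr 1 <;> omega

/-- `foldRange` is a left fold over `List.range'`. [folklore] -/
theorem foldRange_eq_foldl {β : Type} (f : β → ℕ → β) :
    ∀ (i n : ℕ) (acc : β), foldRange f i n acc = (List.range' i n).foldl f acc
  | i, 0, acc => by simp [foldRange]
  | i, n + 1, acc => by
    rw [foldRange, List.range'_succ, List.foldl_cons, foldRange_eq_foldl f (i + 1) n]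


/-- `foldSyms` is a left fold over `symsList`. [folklore] -/
theorem foldSyms_eq_foldl {β : Type} (f : β → ℕ → β) (r : ℕ) (acc : β) :
    foldSyms f r acc = (symsList r).foldl f acc := by
  unfold foldSyms symsList
  by_cases h : r = 0
  · simp [h]
  · simp only [h, ↓reduceIte]; exact foldRange_eq_foldl f _ _ _


/-- `mkR lo hi` is valid for `1 ≤ lo ≤ hi ≤ K`. [folklore] -/
theorem validDom_mkR {lo hi : ℕ} (h1 : 1 ≤ lo) (h2 : lo ≤ hi) (h3 : hi ≤ K) : ValidDom (mkR lo hi) := by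
  right
  have hK : K = 15 := rfl
  have elo : rLo (mkR lo hi) = lo := by unfold rLo mkR; omega
  have ehi : rHi (mkR lo hi) = hi := by unfold rHi mkR; omega
  rw [elo, ehi]
  exact ⟨h1, h2, h3, rfl⟩

/-- The symbols of a valid domain are `< NS`. [folklore] -/
theorem lt_NS_of_mem_symsList {r σ : ℕ} (hr : ValidDom r) (hσ : σ ∈ symsList r) : σ < NS := by
  rw [NS_eq]
  unfold symsList at hσ
  rcases hr with rfl | ⟨h1, h2, h3, _⟩
  · simp at hσ; omega
  · have hne : r ≠ 0 := by
      intro h0; rw [h0] at h1; unfold rLo at h1; simp at h1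
    simp only [hne, ↓reduceIte, List.mem_range'_1] at hσ
    have hK : K = 15 := rfl
    omega

/-- Symbols of a valid domain are `≤ K`. [folklore] -/
theorem le_K_of_mem_symsList {r σ : ℕ} (hr : ValidDom r) (hσ : σ ∈ symsList r) : σ ≤ K := by
  unfold symsList at hσ
  rcases hr with rfl | ⟨h1, h2, h3, _⟩
  · simp at hσ; omega
  · have hne : r ≠ 0 := by
      intro h0; rw [h0] at h1; unfold rLo at h1; simp at h1
    simp only [hne, ↓reduceIte, List.mem_range'_1] at hσ
    omega

/-- **Soundness of `rangeC`**: it encloses whatever one of its cells' basic brackets encloses.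
[folklore] -/
theorem rangeC_sound {a b r σ : ℕ} {θ : ℝ} (hσ : σ ∈ symsList r) (h : Encl (btab a b σ) θ) :
    Encl (rangeC a b r) θ := by
  unfold rangeC
  rw [foldSyms_eq_foldl]
  exact encl_foldl_of_mem (g := fun c => btab a b c) NOBR hσ h

/-- **The table lookup `t1` is `rangeC`** (in range, valid domain). [folklore] -/
theorem t1_eq {a b r : ℕ} (ha : a < NS) (hb : b < NS) (hr : ValidDom r) : t1 a b r = rangeC a b r := by
  unfold t1 T1TAB
  rw [NS_eq] at ha hb ⊢
  rcases hr with rfl | ⟨h1, h2, h3, h4⟩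
  · simp only [↓reduceIte, Nat.add_zero]
    have hidx : (a * 16 + b) * 256 < 16 * 16 * 256 := by omega
    rw [Array.getD_eq_getD_getElem?, Array.getElem?_ofFn]
    simp only [hidx, ↓reduceDIte, Option.getD_some]
    have e1 : (a * 16 + b) * 256 % 256 = 0 := by omega
    have e2 : (a * 16 + b) * 256 / 256 = a * 16 + b := by omega
    simp only [e1, ↓reduceIte, e2]
    congr 1 <;> omega
  · have hne : r ≠ 0 := by
      intro h0; rw [h0] at h1; unfold rLo at h1; simp at h1
    simp only [hne, ↓reduceIte]
    have hK : K = 15 := rfl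
    have hlo : rLo r ≤ 15 := by omega
    have hhi : rHi r < 16 := by unfold rHi; omega
    have hidx : (a * 16 + b) * 256 + (16 * rLo r + rHi r) < 16 * 16 * 256 := by omega
    rw [Array.getD_eq_getD_getElem?, Array.getElem?_ofFn]
    simp only [hidx, ↓reduceDIte, Option.getD_some]
    have e1 : ((a * 16 + b) * 256 + (16 * rLo r + rHi r)) % 256 = 16 * rLo r + rHi r := by omega
    have e2 : ((a * 16 + b) * 256 + (16 * rLo r + rHi r)) / 256 = a * 16 + b := by omega
    have e3 : 16 * rLo r + rHi r ≠ 0 := by omega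
    simp only [e1, e3, ↓reduceIte, e2]
    have e4 : (16 * rLo r + rHi r) / 16 = rLo r := by omega
    have e5 : (16 * rLo r + rHi r) % 16 = rHi r := by omega
    rw [e4, e5, ← h4]
    congr 1 <;> omega

/-- A fold whose steps preserve enclosure preserves enclosure. [folklore] -/
theorem encl_foldl_pres {F : ℕ → ℕ → ℕ} {θ : ℝ} (mono : ∀ acc a, Encl acc θ → Encl (F acc a) θ) :
    ∀ (L : List ℕ) (acc : ℕ), Encl acc θ → Encl (L.foldl F acc) θ
  | [], _, h => h
  | a :: L, acc, h => encl_foldl_pres mono L _ (mono acc a h)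

/-- A fold one of whose steps produces enclosure, all steps preserving it, produces enclosure.
[folklore] -/
theorem encl_foldl_of_step {F : ℕ → ℕ → ℕ} {θ : ℝ} {σ : ℕ}
    (mono : ∀ acc a, Encl acc θ → Encl (F acc a) θ) (step : ∀ acc, Encl (F acc σ) θ) :
    ∀ (L : List ℕ) (acc : ℕ), σ ∈ L → Encl (L.foldl F acc) θ
  | [], _, h => absurd h (by simp)
  | a :: L, acc, h => by
    rw [List.foldl_cons]
    rcases List.mem_cons.1 h with rfl | h'
    · exact encl_foldl_pres mono L _ (step acc)
    · exact encl_foldl_of_step mono step L _ h'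

/-- **Soundness of `rangeBr`**: for symbols `σa ∈ ra`, `σb ∈ rb` (valid domains) and a valid
`rc`, it encloses whatever `rangeC σa σb rc` encloses. [folklore] -/
theorem rangeBr_sound {ra rb rc σa σb : ℕ} {θ : ℝ} (hra : ValidDom ra) (hrb : ValidDom rb)
    (hrc : ValidDom rc) (hσa : σa ∈ symsList ra) (hσb : σb ∈ symsList rb)
    (h : Encl (rangeC σa σb rc) θ) : Encl (rangeBr ra rb rc) θ := by
  have ha := lt_NS_of_mem_symsList hra hσa
  have hb := lt_NS_of_mem_symsList hrb hσb
  have key : Encl (t1 σa σb rc) θ := by rw [t1_eq ha hb hrc]; exact h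
  have inner : ∀ (acc : ℕ), Encl (foldSyms (fun acc' b => brHull acc' (t1 σa b rc)) rb acc) θ := by
    intro acc
    rw [foldSyms_eq_foldl]
    exact encl_foldl_of_mem (g := fun b => t1 σa b rc) acc hσb key
  have mono : ∀ (acc a : ℕ), Encl acc θ →
      Encl (foldSyms (fun acc' b => brHull acc' (t1 a b rc)) rb acc) θ := by
    intro acc a hacc
    rw [foldSyms_eq_foldl]
    exact encl_foldl_of_acc (g := fun b => t1 a b rc) hacc
  unfold rangeBr
  by_cases hra0 : ra = 0
  · have hσa0 : σa = 0 := by unfold symsList at hσa; simpa [hra0] using hσa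
    subst hσa0
    by_cases hrb0 : rb = 0
    · have hσb0 : σb = 0 := by unfold symsList at hσb; simpa [hrb0] using hσb
      subst hσb0
      simp only [hra0, hrb0, ↓reduceIte]
      exact key
    · simp only [hra0, hrb0, ↓reduceIte]
      rw [foldSyms_eq_foldl]
      exact encl_foldl_of_mem (g := fun b => t1 0 b rc) NOBR hσb key
  · by_cases hrb0 : rb = 0
    · have hσb0 : σb = 0 := by unfold symsList at hσb; simpa [hrb0] using hσb
      subst hσb0
      simp only [hra0, hrb0, ↓reduceIte]
      rw [foldSyms_eq_foldl]
      exact encl_foldl_of_mem (g := fun a => t1 a 0 rc) NOBR hσa key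
    · simp only [hra0, hrb0, ↓reduceIte]
      rw [foldSyms_eq_foldl]
      exact encl_foldl_of_step (F := fun acc a => foldSyms (fun acc' b => brHull acc' (t1 a b rc)) rb acc)
        mono inner _ NOBR hσa

/-- A `min`-fold is below its start. [folklore] -/
theorem foldl_minBr_le_init (L : List ℕ) (m : ℕ) :
    L.foldl (fun m br => if br = NOBR then m else min m (brLo br)) m ≤ m := by
  induction L generalizing m with
  | nil => exact le_rfl
  | cons br L ih =>
    rw [List.foldl_cons]
    refine (ih _).trans ?_
    split_ifs
    · exact le_rfl
    · exact min_le_left _ _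

/-- A `min`-fold is below every feasible term. [folklore] -/
theorem foldl_minBr_le_of_mem {L : List ℕ} {br : ℕ} (hbr : br ∈ L) (hne : br ≠ NOBR) (m : ℕ) :
    L.foldl (fun m br => if br = NOBR then m else min m (brLo br)) m ≤ brLo br := by
  induction L generalizing m with
  | nil => exact absurd hbr (by simp)
  | cons x L ih =>
    rw [List.foldl_cons]
    rcases List.mem_cons.1 hbr with rfl | h'
    · rw [if_neg hne]
      exact (foldl_minBr_le_init L _).trans (min_le_right _ _)
    · exact ih h' _

/-- **`THMIN` is below every feasible basic bracket** (with symbols `< NS`). [folklore] -/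
theorem THMIN_le {a b c : ℕ} (ha : a < NS) (hb : b < NS) (hc : c < NS) (h : basic a b c ≠ NOBR) :
    THMIN ≤ brLo (basic a b c) := by
  unfold THMIN
  rw [← Array.foldl_toList]
  refine foldl_minBr_le_of_mem ?_ h NLAD
  unfold BTAB
  rw [Array.toList_ofFn, List.mem_ofFn]
  rw [NS_eq] at ha hb hc
  refine ⟨⟨(a * 16 + b) * 16 + c, by rw [NS_eq]; omega⟩, ?_⟩
  simp only [NS_eq]
  congr 1 <;> omega

end KissingSearch

end Literature.Geometry.DiscreteGeometry
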